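/-
COR-CM (cell pub-hodgecm2) — ¬hJ RUSH, HEAD-B (κ-line ∕ EDITION B), leaf 3∕3: THE CORE.  Pen hmusep-p5 g3, 2026-08-24.
THE SUB-SOCKET ENGINE (a `ℂ[G]`-submodule typed (1,0) + an equivariant, possibly non-injective map typed (0,1), non-zero ⇒ `False` under
multiplicity one and separation; on top of ✔ nothj-p6's `NotHJ.false_of_twoSocket_of_multiplicityFree`, p381288) and THE HEAD-B CORE
`NotHJ.false_of_records_of_multOne_of_PK`: records `J'` (@ῑ₁, R1-inj) and `J₁` (@ι₁) over ANY App.-C datum, the two (P-K)-clauses at the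
Albanese varieties, ONE `𝟙_{A_{K₀}} ≠ 0`, and multiplicity one of the tower (`hss ∕ hmf`, nothj-p4's displayed M2 interface) ⊢ `False`.
THEOREMS (+ `def submoduleOfStable ∕ linearMapOfEquivariant ∕ thr`); no named fact, no `sorry`, no new axiom.  FRAMING: HC_CM is NOT proved;
nothing here asserts hJ, hJ₀, hHom, (P-K), R1 or their negations — all are HYPOTHESES.
-/
import Summits.HodgeConjecture.CorCM.D2Bridge.NotHJKappaTyping
import Summits.HodgeConjecture.CorCM.D2Bridge.NotHJTwoSocket
import Summits.HodgeConjecture.CorCM.D2Bridge.OrientationT2BlockVanishing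
import HarnessLib

set_option autoImplicit false

/-!
# ¬hJ₀, HEAD-B (κ-line), leaf 3∕3: the sub-socket engine and the core

The sub-socket engine (an `of g`-stable `ℂ`-subspace typed (1,0), an equivariant possibly non-injective map typed (0,1), non-zero ⇒ `False`
under multiplicity one and separation; over ✔ `NotHJ.false_of_twoSocket_of_multiplicityFree`) and the core
`NotHJ.false_of_records_of_multOne_of_PK`.  HC_CM is NOT proved; every row-like input is a hypothesis.
-/

noncomputable section

namespace Summit.HodgeConjecture.CorCM.D2Bridge.NotHJ

open Function

/-! ## §1 The abstract lift (verbatim `DirectedSpanLift.lean`) -/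

section Core

open scoped TensorProduct
open CategoryTheory NumberField
open Literature.AlgebraicGeometry.Motives (AbelianVariety bettiCohomology baseChangeHom IsSmoothProjective HodgeStructure)
open Literature.AlgebraicGeometry.Motives.AbelianVariety (Hom.baseChange)
open Literature.AlgebraicGeometry.HodgeTheory
open Literature.AlgebraicGeometry.HodgeTheory.BettiUniverse (pull)
open Literature.AlgebraicGeometry.ShimuraVarieties.UnitaryCanonicalModel (exists_recordSystem)
open Literature.NumberTheory.Automorphic Literature.NumberTheory.Automorphic.Liu2021 Literature.NumberTheory.Automorphic.Liu2021.AppendixC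
open Literature.NumberTheory.Automorphic.PicardCM
open Literature.NumberTheory.Transcendental (Arapura2012_Cor_15_4_6)
open HodgeCM.Model.LevelTranslate HodgeCM.Model.TowerLevel HodgeCM.Model.TowerCarrier
open Summit.HodgeConjecture.CorCM.D2Bridge.TowerRational

variable {hHD : exists_isReal_hodgeModel} {hI : hodgePQ_independent_of_hodgeModel}
  {hU : BallQuotientUniformisedDatum} {h₃ : CMAbelianVarietyRealised} {hA : Arapura2012_Cor_15_4_6}
variable {L : HodgeCM.CMField} {ι₁ : L →+* ℂ} {V : HodgeCM.HermSpace3 L ι₁} {h : exists_recordSystem}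
  {Φ : Literature.AlgebraicGeometry.Motives.CMType L} {isotropicAt : ℕ → Prop}
  {C : Sec42Data (Model.honestP5Of h ⟨L.K⟩ ι₁ ⟨V.Hm, V.isHermitian, V.signature_ι₁, V.posDef_of_ne⟩ Φ) isotropicAt}
  {HT : C.HeckeTranslates}

/-- **Separation, per-vector threshold** (nothj-p4's `submodule_tower_eq_bot_of_deep_res_eq_zero`, `NotHJTwoSocketCore.lean` §2, re-derived
token-for-token until it lands): an `act`-stable `ℂ`-subspace of the tower whose vectors restrict to `0` at every sufficiently deep level is `⊥`
(✔ `submodule_tower_eq_bot_of_res_eq_zero` + ✔ `res_ofLevel_of_le` + ✔ `LevelPullInjective.pull_baseChange_levelCover_injective`). [folklore] -/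
theorem eq_bot_of_deep_res_eq_zero (N : Submodule ℂ (Tower hHD hI hU h₃ hA V))
    (hN : ∀ (g : ↥V.adelicFin) (x : Tower hHD hI hU h₃ hA V), x ∈ N → act hHD hI hU h₃ hA g x ∈ N)
    (h0 : ∀ x ∈ N, ∃ (Γ₁ : HodgeCM.Level V), Γ₁.BelowConjThree ∧ ∀ (Γ : HodgeCM.Level V) (hΓ : Γ.BelowConjThree), Γ ≤ Γ₁ →
      HodgeCM.Model.TowerCarrier.res hHD hI hU h₃ hA Γ hΓ x = 0) :
    N = ⊥ := by
  refine submodule_tower_eq_bot_of_res_eq_zero hHD hI hU h₃ hA N hN (HodgeCM.Level.three V) ?_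
  intro Γ hΓ _ x hx hlev
  obtain ⟨Γ₁, -, hdeep⟩ := h0 x hx
  obtain ⟨c, rfl⟩ := hlev
  have hle : Γ ⊓ Γ₁ ≤ Γ := inf_le_left
  have hΓ' : (Γ ⊓ Γ₁).BelowConjThree := hΓ.of_le hle
  have h01 := hdeep (Γ ⊓ Γ₁) hΓ' inf_le_right
  rw [res_ofLevel_of_le hHD hI hU h₃ hA hle hΓ hΓ' c] at h01
  have key : (BettiUniverse.pull (HodgeCM.Model.levelCover hU h₃ hHD hA Γ (Γ ⊓ Γ₁) (HodgeCM.Level.Γ_mono hle)) 1).baseChange ℂ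
      (HodgeCM.Model.TowerCarrier.res hHD hI hU h₃ hA Γ hΓ (ofLevel hHD hI hU h₃ hA Γ hΓ c)) = 0 := h01
  exact HodgeCM.Model.LevelPullInjective.pull_baseChange_levelCover_injective hHD hU h₃ hA (HodgeCM.Level.Γ_mono hle) 1
    (key.trans (map_zero _).symm)

section SubSocket

variable {R : Type*} [Ring R] {T' : Type*} [AddCommGroup T'] [Module R T'] {M' : Type*} [AddCommGroup M'] [Module R M']
variable {Λ' : Type*} {V' : Λ' → Type*} [∀ i, AddCommGroup (V' i)] [∀ i, Module ℂ (V' i)]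

/-- **A non-zero map out of a semisimple module is non-zero on some simple submodule** (the simple submodules span; Mathlib
`IsSemisimpleModule.sSup_simples_eq_top`). [folklore] -/
theorem exists_simple_comp_subtype_ne_zero {N' : Type*} [AddCommGroup N'] [Module R N'] [IsSemisimpleModule R N']
    (E : N' →ₗ[R] M') (hE : E ≠ 0) :
    ∃ S : Submodule R N', IsSimpleModule R S ∧ E ∘ₗ S.subtype ≠ 0 := by
  by_contra h
  push Not at h
  apply hE
  -- `E` vanishes on every simple submodule, hence on their supremum `⊤`
  have hker : ∀ S : Submodule R N', IsSimpleModule R S → S ≤ LinearMap.ker E := by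
    intro S hS x hx
    have := LinearMap.congr_fun (h S hS) ⟨x, hx⟩
    simpa using this
  have htop : (⊤ : Submodule R N') ≤ LinearMap.ker E := by
    rw [← IsSemisimpleModule.sSup_simples_eq_top]
    exact sSup_le fun S hS => hker S hS
  ext x
  simpa using htop (Submodule.mem_top : x ∈ (⊤ : Submodule R N'))

/-- On a simple module a non-zero linear map is injective (its kernel is a proper submodule). [folklore] -/
theorem injective_of_comp_subtype_ne_zero {N' : Type*} [AddCommGroup N'] [Module R N'] (S : Submodule R N') [IsSimpleModule R S]
    (F : S →ₗ[R] M') (hF : F ≠ 0) : Injective F := by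
  rcases LinearMap.injective_or_eq_zero F with h | h
  · exact h
  · exact (hF h).elim

/-- **THE SUB-SOCKET ENGINE (HEAD-B's assembly shape).**  `T` a semisimple multiplicity-free `R`-module with SEPARATION over admissible
restrictions into DISJOINT pieces `V₁₀ i ∕ V₀₁ i` (as in ✔ `false_of_twoSocket_of_multiplicityFree`); `N ≤ T` an `R`-submodule whose
admissible restrictions are `(1,0)`; `E : N → T` an `R`-linear map whose values restrict into the `(0,1)`-pieces; `E ≠ 0`.  Then `False`.
(HEAD-B: `R = ℂ[U(V)(𝔸_f)]`, `T = 𝔇.H`, `N` = span of the pin's `J′^*_K (H^{1,0}(A_K ⊗_ῑ₁ ℂ))` over all `K` (act-stable by law (iv) + ✔ `pull_hodge`),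
`E` = «`J′^* z ↦ J₁^* (κ⁻¹ z)`» (well defined by R1-injectivity, `(0,1)`-valued by (P-K) + ✔ `pull_hodge`, non-zero by (v′) at `𝟙_{A_K} ≠ 0`).)
[cite: Liu2021, Prop. 4.13, Def. 4.11, App. D Lem. D.1 (3)] [cite: VoisinHodgeI2002, §7.3.2] -/
theorem false_of_subSocket_of_multiplicityFree [IsSemisimpleModule R T']
    (hmf : ∀ S S' : Submodule R T', IsSimpleModule R S → IsSimpleModule R S' → Nonempty (S ≃ₗ[R] S') → S = S')
    (res : ∀ i : Λ', T' → V' i) (adm : Λ' → T' → Prop) (V₁₀ V₀₁ : ∀ i : Λ', Submodule ℂ (V' i))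
    (hdisj : ∀ i, Disjoint (V₁₀ i) (V₀₁ i))
    (sep : ∀ N : Submodule R T', (∀ i, ∀ y ∈ N, adm i y → res i y = 0) → N = ⊥)
    (N : Submodule R T') (E : N →ₗ[R] T') (hE : E ≠ 0)
    (hN₁₀ : ∀ i (x : N), adm i (x : T') → res i (x : T') ∈ V₁₀ i)
    (hE₀₁ : ∀ i (x : N), adm i (E x) → res i (E x) ∈ V₀₁ i) : False := by
  -- a simple `S ≤ N` on which `E` does not vanish; there `E` is injective, and so is the inclusion
  obtain ⟨S, hS, hES⟩ := exists_simple_comp_subtype_ne_zero E hE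
  haveI := hS
  haveI : Nontrivial S := IsSimpleModule.nontrivial R S
  exact false_of_twoSocket_of_multiplicityFree hmf res adm V₁₀ V₀₁ hdisj sep
    (E ∘ₗ S.subtype) (N.subtype ∘ₗ S.subtype)
    (injective_of_comp_subtype_ne_zero S _ hES)
    ((Submodule.injective_subtype N).comp (Submodule.injective_subtype S))
    (fun i w hadm => hE₀₁ i (S.subtype w) hadm) (fun i w hadm => hN₁₀ i (S.subtype w) hadm)

end SubSocket

/-! ## §2 The same engine for `ℂ`-linear, `act`-equivariant data (the tower's `ℂ[G]`-structure is `of g • x = act g x`) -/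

section Act

variable {G : Type*} [Monoid G] {T' : Type*} [AddCommGroup T'] [Module ℂ T'] [Module (MonoidAlgebra ℂ G) T']
  [IsScalarTower ℂ (MonoidAlgebra ℂ G) T']
variable {Λ' : Type*} {V' : Λ' → Type*} [∀ i, AddCommGroup (V' i)] [∀ i, Module ℂ (V' i)]

/-- An `of g`-stable `ℂ`-subspace of a `ℂ[G]`-module is a `ℂ[G]`-submodule (induction on the group algebra). [folklore] -/
def submoduleOfStable (N : Submodule ℂ T') (hN : ∀ (g : G) (x : T'), x ∈ N → MonoidAlgebra.of ℂ G g • x ∈ N) :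
    Submodule (MonoidAlgebra ℂ G) T' where
  carrier := N
  zero_mem' := N.zero_mem
  add_mem' := N.add_mem
  smul_mem' := by
    intro r x hx
    induction r using MonoidAlgebra.induction_on with
    | hM g => exact hN g x hx
    | hadd f g hf hg => rw [add_smul]; exact N.add_mem hf hg
    | hsmul a f hf => rw [smul_assoc]; exact N.smul_mem a hf

/-- Membership in `submoduleOfStable N hN` is membership in `N` (by `rfl`). [folklore] -/
@[simp] theorem mem_submoduleOfStable {N : Submodule ℂ T'} {hN : ∀ (g : G) (x : T'), x ∈ N → MonoidAlgebra.of ℂ G g • x ∈ N}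
    {x : T'} : x ∈ submoduleOfStable N hN ↔ x ∈ N := Iff.rfl

/-- A `ℂ`-linear map out of an `of g`-stable subspace commuting with every `of g` is `ℂ[G]`-linear. [folklore] -/
def linearMapOfEquivariant (N : Submodule ℂ T') (hN : ∀ (g : G) (x : T'), x ∈ N → MonoidAlgebra.of ℂ G g • x ∈ N)
    (E : N →ₗ[ℂ] T') (hEeq : ∀ (g : G) (x : N), E ⟨MonoidAlgebra.of ℂ G g • (x : T'), hN g x x.2⟩ = MonoidAlgebra.of ℂ G g • E x) :
    submoduleOfStable N hN →ₗ[MonoidAlgebra ℂ G] T' where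
  toFun x := E ⟨x, x.2⟩
  map_add' x y := by
    have : (⟨(x + y : submoduleOfStable N hN), (x + y).2⟩ : N) = ⟨x, x.2⟩ + ⟨y, y.2⟩ := rfl
    rw [this, map_add]
  map_smul' r x := by
    simp only [RingHom.id_apply]
    induction r using MonoidAlgebra.induction_on with
    | hM g => exact hEeq g ⟨x, x.2⟩
    | hadd f g hf hg =>
      have e : (⟨((f + g) • x : submoduleOfStable N hN), ((f + g) • x).2⟩ : N) =
          ⟨(f • x : submoduleOfStable N hN), (f • x).2⟩ + ⟨(g • x : submoduleOfStable N hN), (g • x).2⟩ :=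
        Subtype.ext (add_smul f g (x : T'))
      rw [e, map_add, hf, hg, add_smul]
    | hsmul a f hf =>
      have e : (⟨((a • f) • x : submoduleOfStable N hN), ((a • f) • x).2⟩ : N) =
          a • ⟨(f • x : submoduleOfStable N hN), (f • x).2⟩ :=
        Subtype.ext (smul_assoc a f (x : T'))
      rw [e, map_smul, hf, smul_assoc]

/-- **THE SUB-SOCKET ENGINE, `act`-form** (the shape HEAD-B's tower data comes in): `T` a `ℂ[G]`-module (compatible `ℂ`-structure) which is
semisimple with multiplicity one ON ATOMS (nothj-p4's displayed `hss ∕ hmf`), separation for `ℂ[G]`-submodules, disjoint typed pieces; `N` an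
`of g`-stable `ℂ`-subspace typed `(1,0)`, `E : N → T` `ℂ`-linear, commuting with every `of g`, typed `(0,1)`, `E ≠ 0` ⊢ `False`.
[cite: Liu2021, Prop. 4.13, Def. 4.11, App. D Lem. D.1 (3)] [cite: VoisinHodgeI2002, §7.3.2] -/
theorem false_of_subSocket_act
    (hss : IsSemisimpleModule (MonoidAlgebra ℂ G) T')
    (hmf : ∀ S S' : Submodule (MonoidAlgebra ℂ G) T', IsAtom S → IsAtom S' → Nonempty (S ≃ₗ[MonoidAlgebra ℂ G] S') → S = S')
    (res : ∀ i : Λ', T' → V' i) (adm : Λ' → T' → Prop) (V₁₀ V₀₁ : ∀ i : Λ', Submodule ℂ (V' i))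
    (hdisj : ∀ i, Disjoint (V₁₀ i) (V₀₁ i))
    (sep : ∀ N : Submodule (MonoidAlgebra ℂ G) T', (∀ i, ∀ y ∈ N, adm i y → res i y = 0) → N = ⊥)
    (N : Submodule ℂ T') (hN : ∀ (g : G) (x : T'), x ∈ N → MonoidAlgebra.of ℂ G g • x ∈ N)
    (E : N →ₗ[ℂ] T') (hEeq : ∀ (g : G) (x : N), E ⟨MonoidAlgebra.of ℂ G g • (x : T'), hN g x x.2⟩ = MonoidAlgebra.of ℂ G g • E x)
    (hE : E ≠ 0)
    (hN₁₀ : ∀ i (x : N), adm i (x : T') → res i (x : T') ∈ V₁₀ i)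
    (hE₀₁ : ∀ i (x : N), adm i (E x) → res i (E x) ∈ V₀₁ i) : False := by
  haveI := hss
  have hmf' : ∀ S S' : Submodule (MonoidAlgebra ℂ G) T', IsSimpleModule (MonoidAlgebra ℂ G) S →
      IsSimpleModule (MonoidAlgebra ℂ G) S' → Nonempty (S ≃ₗ[MonoidAlgebra ℂ G] S') → S = S' :=
    fun S S' hS hS' e => hmf S S' (isSimpleModule_iff_isAtom.1 hS) (isSimpleModule_iff_isAtom.1 hS') e
  have hE' : linearMapOfEquivariant N hN E hEeq ≠ 0 := by
    intro h0
    apply hE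
    ext x
    have := LinearMap.congr_fun h0 ⟨(x : T'), x.2⟩
    exact this
  exact false_of_subSocket_of_multiplicityFree hmf' res adm V₁₀ V₀₁ hdisj sep (submoduleOfStable N hN)
    (linearMapOfEquivariant N hN E hEeq) hE' (fun i x hadm => hN₁₀ i ⟨x, x.2⟩ hadm) (fun i x hadm => hE₀₁ i ⟨x, x.2⟩ hadm)

end Act

/-! ### The per-vector threshold and THE CORE -/

open scoped Classical in
variable (hHD hI hU h₃ hA V) in
/-- A tower level below which `y` is of type (1,0) if it is deeply (1,0), and of type (0,1) if it is deeply (0,1) (a choice; `three` otherwise).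
[folklore] -/
def thr (y : Tower hHD hI hU h₃ hA V) : HodgeCM.Level V :=
  (if h : DeepTyped hHD hI hU h₃ hA V 1 0 y then Classical.choose h else HodgeCM.Level.three V) ⊓
    (if h : DeepTyped hHD hI hU h₃ hA V 0 1 y then Classical.choose h else HodgeCM.Level.three V)

/-- The threshold is a tower level. [folklore] -/
theorem thr_belowConjThree (y : Tower hHD hI hU h₃ hA V) : (thr hHD hI hU h₃ hA V y).BelowConjThree := by
  unfold thr
  refine HodgeCM.Level.BelowConjThree.of_le ?_ inf_le_left
  split_ifs with h
  · exact (Classical.choose_spec h).1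
  · exact HodgeCM.Level.BelowConjThree.three

/-- Below the threshold a deeply-(1,0) vector restricts into `H^{1,0}`. [folklore] -/
theorem res_mem_piece10_of_le_thr {y : Tower hHD hI hU h₃ hA V} (hy : DeepTyped hHD hI hU h₃ hA V 1 0 y)
    (Γ : HodgeCM.Level V) (hΓ : Γ.BelowConjThree) (hle : Γ ≤ thr hHD hI hU h₃ hA V y) :
    HodgeCM.Model.TowerCarrier.res hHD hI hU h₃ hA Γ hΓ y ∈ (hodgeP hHD hI hU h₃ Γ).piece 1 0 := by
  have h1 : thr hHD hI hU h₃ hA V y ≤ Classical.choose hy := by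
    unfold thr; rw [dif_pos hy]; exact inf_le_left
  exact (Classical.choose_spec hy).2 Γ hΓ (hle.trans h1)

/-- Below the threshold a deeply-(0,1) vector restricts into `H^{0,1}`. [folklore] -/
theorem res_mem_piece01_of_le_thr {y : Tower hHD hI hU h₃ hA V} (hy : DeepTyped hHD hI hU h₃ hA V 0 1 y)
    (Γ : HodgeCM.Level V) (hΓ : Γ.BelowConjThree) (hle : Γ ≤ thr hHD hI hU h₃ hA V y) :
    HodgeCM.Model.TowerCarrier.res hHD hI hU h₃ hA Γ hΓ y ∈ (hodgeP hHD hI hU h₃ Γ).piece 0 1 := by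
  have h1 : thr hHD hI hU h₃ hA V y ≤ Classical.choose hy := by
    unfold thr; rw [dif_pos hy]; exact inf_le_right
  exact (Classical.choose_spec hy).2 Γ hΓ (hle.trans h1)

set_option maxHeartbeats 1600000 in
/-- **THE HEAD-B CORE (κ-line, sub-socket form).**  Over ANY App.-C datum `C` of `(L, ι₁, V, Φ)` with Hecke translates `HT`: a record
`J'` at the conjugate instance `ῑ₁` whose rational pull-backs `J'^*_K` are INJECTIVE (R1-inj; intended: the tree's pin
✔ `componentAlbanesePinTotal`), a record `J₁` at the instance `ι₁` (the HYPOTHESIS hJ₀), the folklore row (P-K) «complex conjugation of points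
exchanges `H^{p,q}` and `H^{q,p}`» (mukey-p10's `BettiConjSwapsHodgePieces`), ONE Albanese `A_{K₀}` with `𝟙_{A_{K₀}} ≠ 0` (NECESSARY for any
¬hJ₀, ✔-desk `TrivialRecord`; from R1-surjectivity + the GOG theta class, nothj-p5's R4), and MULTIPLICITY ONE of the tower
(nothj-p4's displayed `hss ∕ hmf`, Hodge-blind: [Liu2021] Prop. 4.13 + Def. 4.11 + Lem. D.1 (3)) ⊢ `False`.
Mechanism: `N₁₀ := Σ_K J'^* H^{1,0}(A_K ⊗_ῑ₁ ℂ)` is an `act`-stable subspace of the tower, deeply of type (1,0); `E := J₁^* ∘ κ⁻¹ ∘ (J'^*)⁻¹` is a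
well-defined (R1-inj) equivariant map on it, deeply of type (0,1) ((P-K)) and non-zero ((v′) at `𝟙_{A_{K₀}}`); the sub-socket engine
(✔ p381288 + `false_of_subSocket_act`) closes.  NO Thm 4.18, NO `hHom`, NO purity row, NO tower Hodge splitting.
[cite: Liu2021, §4.2 (FJcycle.tex l. 2062–2074), Lemma 2.4 (1), Prop. 4.13, Def. 4.11, App. D Lem. D.1 (3)] [cite: DeligneEtAl1982, I §1]
[cite: VoisinHodgeI2002, §6.1.3 Cor. 6.14 and §7.3.2] -/
theorem false_of_records_of_multOne_of_PK
    (J' : letI := (conjEmb ι₁).toAlgebra; ComponentAlbanese hHD hI hU h₃ hA V h Φ C HT)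
    (hinj : ∀ K : C5.SmallLevel C.S.K₀, Function.Injective (letI := (conjEmb ι₁).toAlgebra; J'.albStarQ K))
    (J₁ : letI := ι₁.toAlgebra; ComponentAlbanese hHD hI hU h₃ hA V h Φ C HT)
    (hPK₁ : ∀ (K : C5.SmallLevel C.S.K₀) (w : ACx (C := C) ι₁ K), w ∈ (hodgeA hHD C ι₁ K).piece 0 1 →
      ((bettiConjLinearEquiv ι₁ (C.A K).X 1).toLinearMap.baseChange ℂ) w ∈ (hodgeA hHD C (conjEmb ι₁) K).piece 1 0)
    (hPK₂ : ∀ (K : C5.SmallLevel C.S.K₀) (w : ACx (C := C) (conjEmb ι₁) K),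
      w ∈ (hodgeA hHD C (conjEmb ι₁) K).piece 1 0 → kappaInvC K w ∈ (hodgeA hHD C ι₁ K).piece 0 1)
    {K₀ : C5.SmallLevel C.S.K₀} (h1 : (𝟙 (C.A K₀) : C.A K₀ ⟶ C.A K₀) ≠ 0)
    (hss : IsSemisimpleModule (MonoidAlgebra ℂ ↥V.adelicFin) (Tower hHD hI hU h₃ hA V))
    (hmf : ∀ S S' : Submodule (MonoidAlgebra ℂ ↥V.adelicFin) (Tower hHD hI hU h₃ hA V),
      IsAtom S → IsAtom S' → Nonempty (S ≃ₗ[MonoidAlgebra ℂ ↥V.adelicFin] S') → S = S') : False := by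
  classical
  obtain ⟨E, hE, hEg⟩ := exists_towerLiftC J' hinj J₁
  -- `N₁₀` is `of g`-stable; `E₁₀ := E|_{N₁₀}` commutes with every `of g`
  have hNof : ∀ (g : ↥V.adelicFin) (x : Tower hHD hI hU h₃ hA V), x ∈ N10 J' →
      MonoidAlgebra.of ℂ ↥V.adelicFin g • x ∈ N10 J' := fun g x hx => by
    rw [of_smul_eq_act]; exact act_mem_N10 J' g hx
  let E10 : N10 J' →ₗ[ℂ] Tower hHD hI hU h₃ hA V := E ∘ₗ Submodule.inclusion (N10_le_pinSpanC J')
  have hE10 : ∀ x : N10 J', E10 x = E ⟨x, N10_le_pinSpanC J' x.2⟩ := fun x => rfl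
  have hEeq : ∀ (g : ↥V.adelicFin) (x : N10 J'),
      E10 ⟨MonoidAlgebra.of ℂ ↥V.adelicFin g • (x : Tower hHD hI hU h₃ hA V), hNof g x x.2⟩ = MonoidAlgebra.of ℂ ↥V.adelicFin g • E10 x := by
    intro g x
    rw [hE10, hE10]
    have hx' : act hHD hI hU h₃ hA g (x : Tower hHD hI hU h₃ hA V) ∈ pinSpanC J' := (hEg g).1 _ (N10_le_pinSpanC J' x.2)
    have e1 : (⟨MonoidAlgebra.of ℂ ↥V.adelicFin g • (x : Tower hHD hI hU h₃ hA V), N10_le_pinSpanC J' (hNof g x x.2)⟩ : pinSpanC J') =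
        ⟨act hHD hI hU h₃ hA g (x : Tower hHD hI hU h₃ hA V), hx'⟩ := Subtype.ext (of_smul_eq_act hHD hI hU h₃ hA g _)
    rw [e1, (hEg g).2 ⟨x, N10_le_pinSpanC J' x.2⟩ hx', of_smul_eq_act]
  -- `E₁₀ ≠ 0`
  have hE10ne : E10 ≠ 0 := by
    obtain ⟨x, hx', hxN, hne⟩ := exists_mem_N10_E_ne_zero hPK₁ J' J₁ E hE h1
    intro h0
    apply hne
    have := LinearMap.congr_fun h0 ⟨x, hxN⟩
    rw [LinearMap.zero_apply] at this
    exact this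
  -- the typing interface: levels, identity-component restrictions, pieces, thresholds
  refine false_of_subSocket_act (G := ↥V.adelicFin) (T' := Tower hHD hI hU h₃ hA V) (Λ' := {Γ : HodgeCM.Level V // Γ.BelowConjThree})
    (V' := fun Γ => (HodgeCM.Model.universeOf hHD hI hU h₃).CohC ((HodgeCM.Model.universeOf hHD hI hU h₃).pms L ι₁ V Γ.1) 1)
    hss hmf (fun Γ y => HodgeCM.Model.TowerCarrier.res hHD hI hU h₃ hA Γ.1 Γ.2 y) (fun Γ y => Γ.1 ≤ thr hHD hI hU h₃ hA V y)
    (fun Γ => (hodgeP hHD hI hU h₃ Γ.1).piece 1 0) (fun Γ => (hodgeP hHD hI hU h₃ Γ.1).piece 0 1)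
    (fun Γ => (isCompl_piece_one_zero_piece_zero_one (hodgeP hHD hI hU h₃ Γ.1) (BettiUniverse.hodge_isEffective hHD _ 1)).disjoint)
    ?_ (N10 J') hNof E10 hEeq hE10ne ?_ ?_
  · -- separation below the thresholds
    intro N₀ h0
    have hC : (N₀.restrictScalars ℂ) = ⊥ := by
      refine eq_bot_of_deep_res_eq_zero (hHD := hHD) (hI := hI) (hU := hU) (h₃ := h₃) (hA := hA) (N₀.restrictScalars ℂ) ?_ ?_
      · intro g y hy
        have hy' : MonoidAlgebra.of ℂ ↥V.adelicFin g • y ∈ N₀ := Submodule.smul_mem N₀ _ hy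
        rw [of_smul_eq_act] at hy'
        exact hy'
      · intro y hy
        exact ⟨thr hHD hI hU h₃ hA V y, thr_belowConjThree y, fun Γ hΓ hle => h0 ⟨Γ, hΓ⟩ y hy hle⟩
    rw [eq_bot_iff]
    intro y hy
    have : y ∈ N₀.restrictScalars ℂ := hy
    rw [hC] at this
    exact this
  · -- `N₁₀` restricts into `H^{1,0}` below the thresholds
    rintro ⟨Γ, hΓ⟩ x hle
    exact res_mem_piece10_of_le_thr (deepTyped_of_mem_N10 J' x.2) Γ hΓ hle
  · -- `E(N₁₀)` restricts into `H^{0,1}` below the thresholds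
    rintro ⟨Γ, hΓ⟩ x hle
    rw [hE10] at hle ⊢
    exact res_mem_piece01_of_le_thr (deepTyped_E_of_mem_N10 hPK₂ J' J₁ E hE x.2 (N10_le_pinSpanC J' x.2)) Γ hΓ hle

end Core

end Summit.HodgeConjecture.CorCM.D2Bridge.NotHJ

end
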